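import Summits.QuantumFields.BalabanUV.Beta.D1BFx.HessKerConjugation
import Summits.QuantumFields.BalabanUV.Beta.D1BFx.FineHessianLegGrades
import Summits.QuantumFields.BalabanUV.Beta.RelInvCongruenceKernel

/-!
# `BalabanUV.Beta.D1BFx.ChartDefectCorrectorChannel` — road «BF-x», binder row D1, PART 24-hyb HEAD RE-PAIRED, the OWNER's leg (c2), PART 4:
# **Φ-CHANNEL ISOLATION — the corrector-BLIND part of the road's kernel enters the (lead)-type difference through ONE bilinear word.**

ABSTRACT SETTING ([folklore] tame-kernel algebra; generic site dimension `D`, fibre `F`).  `K` (the road's kernel), `Φ` (any spread part of it), `T` (a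
corrector) spread; `P := idK + T`; the corrector is BLIND to `Φ`: `T∘Φ = 0`, `Φ∘Tᵀ = 0` (at the record: `T := Ẽ` is field–field, so every kernel
supported on multiplier legs — in particular the road kernel's multiplier–multiplier block, leaf-01's `Φ` — qualifies; PART 1 ∕ PART 3).  Then
§1 `P∘Φ∘Pᵀ = Φ` (`conj_blind`), so the kernel difference does not see `Φ`: `P∘K∘Pᵀ − K = P∘(K − Φ)∘Pᵀ − (K − Φ)` (`conj_sub_eq_conj_sub_blind`);
§2 additivity of `tadpole` ∕ the bubble trace in the KERNEL slot (`tadpole_add_kernel`, `tr_four_expand`);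
§3 **`conjDefect_eq_blind_add_channel`**: for localised vertex families `V`, `W`,
`hessKer (P∘K∘Pᵀ) V W μ ν z − hessKer K V W μ ν z`
`  = (hessKer (P∘(K−Φ)∘Pᵀ) V W μ ν z − hessKer (K−Φ) V W μ ν z) − ½·(tr (Φ∘V μ0∘(P∘K∘Pᵀ − K)∘V νz) + tr (Φ∘V νz∘(P∘K∘Pᵀ − K)∘V μ0))`
— the (lead)-type difference splits into the SAME difference for the corrector-VISIBLE kernel `K − Φ` plus ONE explicit bilinear «Φ-channel» word:
`Φ` between two vertex legs, the KERNEL DIFFERENCE `P∘K∘Pᵀ − K` between the other two.  At the record (PART 2: `P∘G₀∘Pᵀ − G₀ = Ẽ∘G₀ + G₀∘Ẽᵀ + Ẽ∘G₀∘Ẽᵀ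
= −G₀∘Dsh∘G′`, `Φ :=` the multiplier–multiplier block of `G₀`) this is leaf-01 g35's located residual `−ΣFF(Y,Y′)·⟨𝒬A^ν_{Y′}, Φ𝒬A^μ_Y⟩` as an EXACT identity:
the multiplier–multiplier block of the road's kernel meets (lead) only through the two multiplier legs of the dressed vertex, against the corrector-dressed
field propagator.  Located, zero weight: NO word is priced, NO n-law asserted.

HONEST DEPENDENCY (cell records, verbatim): «continuum YM on T⁴ ⇐ BetaPertH ∧ nine spine estimates (0/9 proved); BetaPertH ⇐ (D1) ∧ (D4) ∧
CAP+tail; G-an2-4 gates asym, D1 and NE2/3/4.»  HONEST FRAMING (cell contract, verbatim): «discharging `BetaPertH` makes Bałaban's UV stability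
UNCONDITIONAL — a real constructive-QFT result; it is NOT the continuum limit and NOT the Clay problem.»  THIS MODULE DISCHARGES NOTHING of the wall:
[folklore] tame-kernel algebra (`comp_assoc_tame`, `tr_comp_comm_loc`, `tr_add_loc`, distributivity, `FineHessianLegGrades.spr_sub'`) over ABSTRACT kernels; the blindness relations are
HYPOTHESES here (PART 1 ∕ 3 supply them at the record).  No definition, no `def … : Prop`, nothing cited, 0 sorry, default heartbeats.  0∕4 row-D1 binders;
(K) NOT closed; (J1) ONE OPEN ROW; NOT D1, NEVER «G-an2-4 closed», NOT `BetaPertH`, NOT continuum, NOT Clay.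

ABSOLUTE RULE (cell charter, verbatim): «No internally-minted statement may enter as a cited fact. Every hypothesis is either kernel-proved in this
package or a verbatim quotation of a PUBLISHED theorem with page reference. The manuscript(s) under audit are NOT citable for their own disputed
steps — they are the thing under adjudication; programme-internal (2001/route/tribunal) claims are never citable.»

Unit `b2b-balaban-beta-d1-p2` (road owner, gen 27), 2026-08-24; no existing file touched.
-/

noncomputable section

namespace Summit.QuantumFields.BalabanUV.Beta.D1BFx.ChartDefectCorrectorChannel

open Literature.MathematicalPhysics.QuantumFieldTheory.Balaban1983to89
open Literature.MathematicalPhysics.QuantumFieldTheory.Balaban1983to89.Beta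
open ExpKernelCalculus (MKer comp tr tadpole bubble hessKer)
open HessKerSchurResolvent (idK comp_idK_left comp_idK_right)
open Summit.QuantumFields.BalabanUV.Beta.TameKernelCalculus
open Summit.QuantumFields.BalabanUV.Beta.ChartConjugationRelative (spr_comp)
open Summit.QuantumFields.BalabanUV.Beta.RelInvCongruenceKernel (trK_idK)
open Summit.QuantumFields.BalabanUV.Beta.D1BFx.FineHessianLegGrades (spr_sub' spr_add')

variable {D : ℕ} {F : Type*} [Fintype F]

/-! ## §1 The corrector-blind part is conjugation-invariant -/

section Blind

variable [DecidableEq F] {K Φ T : MKer D F} (hK : Spr K) (hΦ : Spr Φ) (hT : Spr T) (h1 : comp T Φ = 0) (h2 : comp Φ (trK T) = 0)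
include hK hΦ hT h1 h2

omit hK in
/-- [folklore] **`(idK + T)∘Φ∘(idK + T)ᵀ = Φ`** when `T∘Φ = 0` and `Φ∘Tᵀ = 0`. -/
theorem conj_blind : comp (comp (idK + T) Φ) (trK (idK + T)) = Φ := by
  have hI : Tame (idK : MKer D F) := spr_idK.tame
  rw [comp_add_left_tame hI hT.tame hΦ.tame, comp_idK_left, h1, add_zero, trK_add, trK_idK,
    comp_add_right_tame hΦ.tame hI hT.trK.tame, comp_idK_right, h2, add_zero]

/-- [folklore] **THE KERNEL DIFFERENCE DOES NOT SEE THE BLIND PART**: `P∘K∘Pᵀ − K = P∘(K − Φ)∘Pᵀ − (K − Φ)`, `P := idK + T`. -/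
theorem conj_sub_eq_conj_sub_blind :
    comp (comp (idK + T) K) (trK (idK + T)) - K = comp (comp (idK + T) (K - Φ)) (trK (idK + T)) - (K - Φ) := by
  have hP : Spr (idK + T) := spr_add' spr_idK hT
  have hR : Spr (K - Φ) := spr_sub' hK hΦ
  have e : K = (K - Φ) + Φ := by abel
  conv_lhs => rw [e]
  rw [comp_add_right_tame hP.tame hR.tame hΦ.tame, comp_add_left_tame (spr_comp hP hR).tame (spr_comp hP hΦ).tame hP.trK.tame,
    conj_blind hΦ hT h1 h2]
  abel

end Blind

/-! ## §2 Additivity in the kernel slot -/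

section Additive

variable {A B : MKer D F} (hA : Spr A) (hB : Spr B)
include hA hB

/-- [folklore] `tadpole (A + B) X = tadpole A X + tadpole B X` for spread `A, B` and localised `X`. -/
theorem tadpole_add_kernel {X : MKer D F} (hX : Loc X) : tadpole (A + B) X = tadpole A X + tadpole B X := by
  unfold ExpKernelCalculus.tadpole
  rw [comp_add_left_tame hA.tame hB.tame hX.tame, tr_add_loc (hA.comp_loc hX) (hB.comp_loc hX)]

/-- [folklore] `tr ((A + B)∘X∘(A + B)∘Y) = tr (A∘X∘A∘Y) + tr (A∘X∘B∘Y) + tr (B∘X∘A∘Y) + tr (B∘X∘B∘Y)` (spread `A, B`; localised `X, Y`) — the bubble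
integrand in the kernel slot. -/
theorem tr_four_expand {X Y : MKer D F} (hX : Loc X) (hY : Loc Y) :
    tr (comp (comp (A + B) X) (comp (A + B) Y))
      = tr (comp (comp A X) (comp A Y)) + tr (comp (comp A X) (comp B Y)) + tr (comp (comp B X) (comp A Y)) + tr (comp (comp B X) (comp B Y)) := by
  have hAX : Loc (comp A X) := hA.comp_loc hX
  have hBX : Loc (comp B X) := hB.comp_loc hX
  have hAY : Loc (comp A Y) := hA.comp_loc hY
  have hBY : Loc (comp B Y) := hB.comp_loc hY
  rw [comp_add_left_tame hA.tame hB.tame hX.tame, comp_add_left_tame hA.tame hB.tame hY.tame,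
    comp_add_left_tame hAX.tame hBX.tame (hAY.add hBY).tame,
    comp_add_right_tame hAX.tame hAY.tame hBY.tame, comp_add_right_tame hBX.tame hAY.tame hBY.tame,
    tr_add_loc ((hAX.comp hAY).add (hAX.comp hBY)) ((hBX.comp hAY).add (hBX.comp hBY)),
    tr_add_loc (hAX.comp hAY) (hAX.comp hBY), tr_add_loc (hBX.comp hAY) (hBX.comp hBY)]
  ring

end Additive

/-! ## §3 Φ-channel isolation -/

section Channel

variable [DecidableEq F] {K Φ T : MKer D F} (hK : Spr K) (hΦ : Spr Φ) (hT : Spr T) (h1 : comp T Φ = 0) (h2 : comp Φ (trK T) = 0)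
  {V : Fin D → (Fin D → ℤ) → MKer D F} {W : Fin D → (Fin D → ℤ) → Fin D → (Fin D → ℤ) → MKer D F}
  (hV : ∀ μ y, Loc (V μ y)) (hW : ∀ μ y ν y', Loc (W μ y ν y'))
include hK hΦ hT h1 h2 hV hW

/-- [folklore] **Φ-CHANNEL ISOLATION.**  `K, Φ, T` spread, `T∘Φ = 0 = Φ∘Tᵀ`, `P := idK + T`, `V`, `W` localised:
`hessKer (P∘K∘Pᵀ) V W μ ν z − hessKer K V W μ ν z = (hessKer (P∘(K−Φ)∘Pᵀ) V W μ ν z − hessKer (K−Φ) V W μ ν z)`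
`  − ½·(tr (Φ∘V μ0∘(P∘K∘Pᵀ − K)∘V νz) + tr (Φ∘V νz∘(P∘K∘Pᵀ − K)∘V μ0))`.
(The tadpole halves agree; in the bubble the cross terms `tr((P(K−Φ)Pᵀ)∘V∘Φ∘V′) − tr((K−Φ)∘V∘Φ∘V′)` and its mirror collect, by cyclicity, into the displayed word
with `P∘(K−Φ)∘Pᵀ − (K−Φ) = P∘K∘Pᵀ − K`; the `Φ–Φ` terms cancel.) -/
theorem conjDefect_eq_blind_add_channel (μ ν : Fin D) (z : Fin D → ℤ) :
    hessKer (comp (comp (idK + T) K) (trK (idK + T))) V W μ ν z - hessKer K V W μ ν z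
      = (hessKer (comp (comp (idK + T) (K - Φ)) (trK (idK + T))) V W μ ν z - hessKer (K - Φ) V W μ ν z)
        - (1 / 2) * (tr (comp (comp (comp Φ (V μ 0)) (comp (comp (idK + T) K) (trK (idK + T)) - K)) (V ν z))
                    + tr (comp (comp (comp Φ (V ν z)) (comp (comp (idK + T) K) (trK (idK + T)) - K)) (V μ 0))) := by
  have hP : Spr (idK + T) := spr_add' spr_idK hT
  have hR : Spr (K - Φ) := spr_sub' hK hΦ
  set P : MKer D F := idK + T with hPdef
  set R : MKer D F := K - Φ with hRdef
  have eK : K = R + Φ := by rw [hRdef]; abel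
  -- `P∘K∘Pᵀ = P∘R∘Pᵀ + Φ`
  have ePK : comp (comp P K) (trK P) = comp (comp P R) (trK P) + Φ := by
    rw [eK, comp_add_right_tame hP.tame hR.tame hΦ.tame, comp_add_left_tame (spr_comp hP hR).tame (spr_comp hP hΦ).tame hP.trK.tame,
      hPdef, conj_blind hΦ hT h1 h2]
  set A : MKer D F := comp (comp P R) (trK P) with hAdef
  have hAs : Spr A := spr_comp (spr_comp hP hR) hP.trK
  have hAR : Spr (A - R) := spr_sub' hAs hR
  -- the kernel difference `Δ := P∘K∘Pᵀ − K = A − R`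
  have eΔ : comp (comp P K) (trK P) - K = A - R := by rw [ePK, eK]; abel
  have hV1 : Loc (V μ 0) := hV μ 0
  have hV2 : Loc (V ν z) := hV ν z
  have hWl : Loc (W μ 0 ν z) := hW μ 0 ν z
  have hY1 : Loc (comp Φ (V μ 0)) := hΦ.comp_loc hV1
  have hY2 : Loc (comp Φ (V ν z)) := hΦ.comp_loc hV2
  -- the two channel words, opened: `tr (Φ∘V₁∘(A−R)∘V₂) = tr (A∘V₂∘Φ∘V₁) − tr (R∘V₂∘Φ∘V₁)` and its mirror
  have c1 : tr (comp (comp (comp Φ (V μ 0)) (A - R)) (V ν z))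
      = tr (comp (comp A (V ν z)) (comp Φ (V μ 0))) - tr (comp (comp R (V ν z)) (comp Φ (V μ 0))) := by
    calc tr (comp (comp (comp Φ (V μ 0)) (A - R)) (V ν z))
        = tr (comp (comp Φ (V μ 0)) (comp (A - R) (V ν z))) := by rw [← comp_assoc_tame hY1.tame hAR.tame hV2.tame]
      _ = tr (comp (comp (A - R) (V ν z)) (comp Φ (V μ 0))) := tr_comp_comm_loc hY1 (hAR.comp_loc hV2).tame
      _ = tr (comp (comp A (V ν z)) (comp Φ (V μ 0)) - comp (comp R (V ν z)) (comp Φ (V μ 0))) := by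
          rw [comp_sub_left_tame hAs.tame hR.tame hV2.tame, comp_sub_left_tame (hAs.comp_loc hV2).tame (hR.comp_loc hV2).tame hY1.tame]
      _ = _ := tr_sub_loc ((hAs.comp_loc hV2).comp hY1) ((hR.comp_loc hV2).comp hY1)
  have c2 : tr (comp (comp (comp Φ (V ν z)) (A - R)) (V μ 0))
      = tr (comp (comp A (V μ 0)) (comp Φ (V ν z))) - tr (comp (comp R (V μ 0)) (comp Φ (V ν z))) := by
    calc tr (comp (comp (comp Φ (V ν z)) (A - R)) (V μ 0))
        = tr (comp (comp Φ (V ν z)) (comp (A - R) (V μ 0))) := by rw [← comp_assoc_tame hY2.tame hAR.tame hV1.tame]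
      _ = tr (comp (comp (A - R) (V μ 0)) (comp Φ (V ν z))) := tr_comp_comm_loc hY2 (hAR.comp_loc hV1).tame
      _ = tr (comp (comp A (V μ 0)) (comp Φ (V ν z)) - comp (comp R (V μ 0)) (comp Φ (V ν z))) := by
          rw [comp_sub_left_tame hAs.tame hR.tame hV1.tame, comp_sub_left_tame (hAs.comp_loc hV1).tame (hR.comp_loc hV1).tame hY2.tame]
      _ = _ := tr_sub_loc ((hAs.comp_loc hV1).comp hY2) ((hR.comp_loc hV1).comp hY2)
  -- the mirror words `tr (Φ∘V₁∘X∘V₂) = tr (X∘V₂∘Φ∘V₁)` by cyclicity (`X = A, R`)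
  have m1 : tr (comp (comp Φ (V μ 0)) (comp A (V ν z))) = tr (comp (comp A (V ν z)) (comp Φ (V μ 0))) :=
    tr_comp_comm_loc hY1 (hAs.comp_loc hV2).tame
  have m2 : tr (comp (comp Φ (V μ 0)) (comp R (V ν z))) = tr (comp (comp R (V ν z)) (comp Φ (V μ 0))) :=
    tr_comp_comm_loc hY1 (hR.comp_loc hV2).tame
  -- expand everything and collect
  rw [eΔ, ePK, eK]
  unfold ExpKernelCalculus.hessKer ExpKernelCalculus.bubble
  rw [tadpole_add_kernel hAs hΦ hWl, tadpole_add_kernel hR hΦ hWl, tr_four_expand hAs hΦ hV1 hV2, tr_four_expand hR hΦ hV1 hV2,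
    c1, c2, m1, m2]
  ring

end Channel

end Summit.QuantumFields.BalabanUV.Beta.D1BFx.ChartDefectCorrectorChannel

end
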